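import Mathlib
import HarnessLib
import Summits.Ventures.LatticeQCDFlow.Exactness.U1JitteredHMCAtomless
import Summits.Ventures.LatticeQCDFlow.Exactness.WilsonJitterZeroConsistency

/-!
# The Doeblin constant of a jittered HMC kernel is the `η`-AVERAGE of the fixed-label constants (not their minimum): label-dependent minorants integrate

HONEST FRAMING: exact (Metropolis-corrected) sampling algorithms for lattice gauge theory;
figures of merit are autocorrelation/cost numbers at stated couplings and volumes; no
continuum-physics claim.

Venture `LatticeQCDFlow` (cell pub-lqcd), topic `Exactness`, FANOUT row 9 (eng-latcore, GEN-25).  The engines' `tau_jitter`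
paths (`hmc.HMC.trajectory(..., tau_jitter)` on SU(N); `u1_2d.U1Field2D.hmc_trajectory(β, τ, nstep, tau_jitter)`).  NEW WORK
of the cell over GEN-24's `SUNJitteredHMCMeasurableLabels.lean` (`wilsonJitterHMCL_apply`: the jittered engine kernel is the
`η`-integral of the frozen kernels), `SUNLeapfrogHMCUniformCertificates.lean` (`wilsonLeapfrogHMC`, the DEFAULT fixed-length
engine kernel), `WilsonJitterZeroConsistency.lean` (`wilsonJitterHMCL_dirac`) and `U1JitteredHMCAtomless.lean`
(`u1JitterHMCL_apply`).  GEN-24's transfer lemmas (`smul_le_wilsonJitterHMCL_of_common_minorant`,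
`smul_le_u1JitterHMCL_of_minorant`) pass a CONSTANT minorant shared on a label set `G` with the factor `η(G)` — the
certificates of the tree therefore carry `η[τ₁, τ₂] · (min over the window)`.  This file passes a LABEL-DEPENDENT minorant:
if `e(l) • ν ≤ K_l(U, ·)` for every label `l` and configuration `U` (`e` measurable), then `(∫ e dη) • ν ≤ K_jit(U, ·)` —
the jittered kernel's Doeblin constant is the AVERAGE of the frozen constants under the law of the label.  Mathlib only
(`lintegral_mono`, `lintegral_mul_const`, `Measure.le_iff`) over the tree's integral formulas; nothing is cited as a fact; no
number is claimed.

## Content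

* **`lintegral_smul_le_wilsonJitterHMCL`** — SU(N) engine, ANY law `η` of the length: `∀ τ' U, e τ' • ν ≤ K_{τ'}(U, ·)` with
  `K_{τ'} = wilsonLeapfrogHMC N d L β nstep τ'` ⇒ `(∫ e dη) • ν ≤ wilsonJitterHMCL N d L β nstep η U` for every `U`;
  **`lintegral_smul_le_wilsonJitterHMCL_of_window`** — the same when the minorant is only known on a measurable label set
  `G` (`e` vanishes elsewhere by an indicator): `(∫_G e dη) • ν ≤ K_jit(U, ·)`; GEN-24's constant case is `e = κ·𝟙_G`
  (`smul_le_wilsonJitterHMCL_of_indicator_const`: `(η(G)·κ) • ν ≤ K_jit(U, ·)`).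
* **`lintegral_smul_le_u1JitterHMCL`**, **`lintegral_smul_le_u1JitterHMCL_of_window`** — the `U(1)` twins for GEN-24's
  labelled kernel `u1JitterHMCL` (any label space, any law).

NOT CLAIMED: any value of a constant; that the average is large; floating point.
-/

noncomputable section

namespace Summit.Ventures.LatticeQCDFlow.Exactness

open MeasureTheory ProbabilityTheory ProbabilityTheory.Kernel Set Function
open Literature.MathematicalPhysics.QuantumFieldTheory
open scoped ENNReal NNReal

set_option backward.isDefEq.respectTransparency false

/-! ## §1 The SU(N) engine: label-dependent minorants integrate -/

section SUN

variable {N d L : ℕ} [NeZero L]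

/-- **THE DOEBLIN CONSTANT OF THE JITTERED ENGINE KERNEL IS THE `η`-AVERAGE OF THE FIXED-LENGTH CONSTANTS**: if
`e(τ') • ν ≤ K_{τ'}(U, ·)` for every length `τ'` and every configuration `U`, with `e` measurable and
`K_{τ'} = wilsonLeapfrogHMC N d L β nstep τ'`, then `(∫ e dη) • ν ≤ K_η(U, ·)` for every `U` and EVERY s-finite law `η`. -/
theorem lintegral_smul_le_wilsonJitterHMCL (β : ℝ) (nstep : ℕ) (η : Measure ℝ) [SFinite η]
    {ν : Measure (GaugeConfig d L (Matrix.specialUnitaryGroup (Fin N) ℂ))} {e : ℝ → ℝ≥0∞} (he : Measurable e)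
    (hmin : ∀ (τ' : ℝ) (U : GaugeConfig d L (Matrix.specialUnitaryGroup (Fin N) ℂ)),
      e τ' • ν ≤ wilsonLeapfrogHMC N d L β nstep τ' U)
    (U : GaugeConfig d L (Matrix.specialUnitaryGroup (Fin N) ℂ)) :
    (∫⁻ τ', e τ' ∂η) • ν ≤ wilsonJitterHMCL N d L β nstep η U := by
  refine Measure.le_iff.2 fun A hA => ?_
  rw [Measure.smul_apply, smul_eq_mul, wilsonJitterHMCL_apply (N := N) (d := d) (L := L) β nstep η U hA,
    ← lintegral_mul_const _ he]
  refine lintegral_mono fun τ' => ?_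
  have h := Measure.le_iff'.1 (hmin τ' U) A
  rw [Measure.smul_apply, smul_eq_mul] at h
  exact h

/-- **THE SAME WITH THE MINORANT KNOWN ONLY ON A WINDOW `G`**: `e(τ') • ν ≤ K_{τ'}(U, ·)` for `τ' ∈ G` (measurable) ⇒
`(∫_G e dη) • ν ≤ K_η(U, ·)`. -/
theorem lintegral_smul_le_wilsonJitterHMCL_of_window (β : ℝ) (nstep : ℕ) (η : Measure ℝ) [SFinite η]
    {G : Set ℝ} (hG : MeasurableSet G)
    {ν : Measure (GaugeConfig d L (Matrix.specialUnitaryGroup (Fin N) ℂ))} {e : ℝ → ℝ≥0∞} (he : Measurable e)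
    (hmin : ∀ τ' ∈ G, ∀ U : GaugeConfig d L (Matrix.specialUnitaryGroup (Fin N) ℂ),
      e τ' • ν ≤ wilsonLeapfrogHMC N d L β nstep τ' U)
    (U : GaugeConfig d L (Matrix.specialUnitaryGroup (Fin N) ℂ)) :
    (∫⁻ τ' in G, e τ' ∂η) • ν ≤ wilsonJitterHMCL N d L β nstep η U := by
  rw [← lintegral_indicator hG]
  refine lintegral_smul_le_wilsonJitterHMCL β nstep η (he.indicator hG) (fun τ' V => ?_) U
  by_cases hτ' : τ' ∈ G
  · rw [indicator_of_mem hτ']; exact hmin τ' hτ' V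
  · rw [indicator_of_notMem hτ', zero_smul]; exact bot_le

/-- GEN-24's constant case as an instance: a constant `κ` shared on `G` gives `(η(G)·κ) • ν ≤ K_η(U, ·)`. -/
theorem smul_le_wilsonJitterHMCL_of_indicator_const (β : ℝ) (nstep : ℕ) (η : Measure ℝ) [SFinite η]
    {G : Set ℝ} (hG : MeasurableSet G)
    {ν : Measure (GaugeConfig d L (Matrix.specialUnitaryGroup (Fin N) ℂ))} {κ : ℝ≥0∞}
    (hmin : ∀ τ' ∈ G, ∀ U : GaugeConfig d L (Matrix.specialUnitaryGroup (Fin N) ℂ),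
      κ • ν ≤ wilsonLeapfrogHMC N d L β nstep τ' U)
    (U : GaugeConfig d L (Matrix.specialUnitaryGroup (Fin N) ℂ)) :
    (η G * κ) • ν ≤ wilsonJitterHMCL N d L β nstep η U := by
  have h := lintegral_smul_le_wilsonJitterHMCL_of_window (N := N) (d := d) (L := L) β nstep η hG (ν := ν)
    (e := fun _ => κ) measurable_const hmin U
  rwa [MeasureTheory.setLIntegral_const, mul_comm] at h

end SUN

/-! ## §2 The `U(1)` labelled kernel: label-dependent minorants integrate -/

section U1

variable {ι : Type*} [Fintype ι] {Lab : Type*} [MeasurableSpace Lab]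
variable {ε : Lab → ℝ} {hε : Measurable ε} {g : Lab → (ι → Circle) → ι → ℝ}
  {hg : Measurable fun q : Lab × (ι → Circle) => g q.1 q.2} {κ : ℝ} {S : (ι → Circle) → ℝ} {N : Lab → ℕ}
  {hN : Measurable N} {η : Measure Lab}

/-- **`U(1)`: THE DOEBLIN CONSTANT OF THE JITTERED KERNEL IS THE `η`-AVERAGE OF THE FROZEN CONSTANTS** (any measurable
label space, any s-finite law): `e(l) • ν ≤ K_l(U, ·)` for all `l, U` with `e` measurable ⇒ `(∫ e dη) • ν ≤ K_jit(U, ·)`. -/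
theorem lintegral_smul_le_u1JitterHMCL [SFinite η] [Fact (0 < κ)] (hS : Measurable S) {ν : Measure (ι → Circle)}
    {e : Lab → ℝ≥0∞} (he : Measurable e)
    (hmin : ∀ (l : Lab) (U : ι → Circle), e l • ν ≤ u1LeapfrogHMCN (ε l) κ (measurable_slice_of_uncurry hg l) S (N l) U)
    (U : ι → Circle) :
    (∫⁻ l, e l ∂η) • ν ≤ u1JitterHMCL hε hg κ S hN η U := by
  refine Measure.le_iff.2 fun A hA => ?_
  rw [Measure.smul_apply, smul_eq_mul, u1JitterHMCL_apply hS U hA, ← lintegral_mul_const _ he]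
  refine lintegral_mono fun l => ?_
  have h := Measure.le_iff'.1 (hmin l U) A
  rw [Measure.smul_apply, smul_eq_mul] at h
  exact h

/-- **`U(1)`: the same with the minorant known only on a measurable label set `G`**: `(∫_G e dη) • ν ≤ K_jit(U, ·)`. -/
theorem lintegral_smul_le_u1JitterHMCL_of_window [SFinite η] [Fact (0 < κ)] (hS : Measurable S) {G : Set Lab}
    (hG : MeasurableSet G) {ν : Measure (ι → Circle)} {e : Lab → ℝ≥0∞} (he : Measurable e)
    (hmin : ∀ l ∈ G, ∀ U : ι → Circle, e l • ν ≤ u1LeapfrogHMCN (ε l) κ (measurable_slice_of_uncurry hg l) S (N l) U)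
    (U : ι → Circle) :
    (∫⁻ l in G, e l ∂η) • ν ≤ u1JitterHMCL hε hg κ S hN η U := by
  rw [← lintegral_indicator hG]
  refine lintegral_smul_le_u1JitterHMCL hS (he.indicator hG) (fun l V => ?_) U
  by_cases hl : l ∈ G
  · rw [indicator_of_mem hl]; exact hmin l hl V
  · rw [indicator_of_notMem hl, zero_smul]; exact bot_le

end U1

end Summit.Ventures.LatticeQCDFlow.Exactness

end
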